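import Summits.BirchSwinnertonDyer.BirchSwinnertonDyer.Theorems.PrintCFramJZeroThreeTraceForm
import Summits.BirchSwinnertonDyer.Rank1Residual.X12.CubicModelKodaira
import Summits.BirchSwinnertonDyer.Rank1Residual.X12.JZeroThreeDescent
import Literature.NumberTheory.EllipticCurves.LocalEulerFactorModel
import HarnessLib

/-!
# K12r@3 — the `hbad` binder of the `j = 0` trace form DISCHARGED: a Mordell curve
# `y² = x³ + k` with `k ∈ ℤ` SIXTH-POWER-FREE is bad at every prime `ℓ ∣ k`
# (cell `bsd-print-cfram`, seat p3 g1; «3-unit regime» of crux C1, stmt-BirchSwinnertonDyer-20371)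

HONEST FRAMING (cell `bsd-print-cfram`, run/shared/lean/pub/bsd-print-cfram/, D-0131 (2) print
tier; verbatim in every file of the cell): the cell works the partition leaf
`CornerF ∧ p ramified in the CM field K` (LADDER-BSD row K7r = B13; W-ALL row 12r) in PARTITION
currency — a leaf or a cell counts only when its theorem is in the kernel BY NAME. Nothing here is a
Literature statement, no named fact is introduced, nothing is asserted about BSD; beyond-print: NO.

`PrintCFram.hss_three_of_sq_twist` (p542185) discharges Kriz–Li's `hss` for `W ≅ y² = x³ + d·m²`
modulo two per-curve facts, `h2` and `hbad` («`W` is bad at every odd prime dividing the squarefree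
`d`»). This file proves `hbad` ONCE, for the canonical integral presentation: if
`W ≅ y² = x³ + k` with `k ∈ ℤ` and `ℓ ≥ 5` is a prime with `ℓ ∣ k`, `ℓ⁶ ∤ k`, then `W` is BAD at
`ℓ` — Tate's algorithm on `y² = x³ + ℓˢ m` (`1 ≤ s ≤ 5`, `ℓ ∤ m`; the equation is `ℓ`-minimal,
`ord_ℓ Δ = 2s < 12`) returns `II, IV, I₀*, IV*, II*`, never `I₀` (tree engine
`X12.kodairaSymbolAt_of_cubic_model` + `TateAlgorithm.isGood_kodairaSymbolAt_iff_holds`); at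
`ℓ = 3` every `j = 0` curve is bad (`JZeroThree.not_good_three_of_j_eq_zero`). Hence:

* `not_hasGoodReductionAtPrime_of_dvd_mordell` — the Tate statement (`ℓ ≥ 5`).
* `hbad_of_sixthPowerFree` — the `hbad` binder for `k = d·m²`, `d` squarefree, `k` sixth-power-free:
  every ODD prime `ℓ ∣ d` is bad for `W`.
* **`hss_three_of_mordell_int`** — `hss_three_of_sq_twist` with `hbad` DISCHARGED: for
  `C • W = y² = x³ + d·m²` (`d, m ∈ ℤ`, `d` squarefree, `d·m²` sixth-power-free — the normal form
  every `j = 0` class has), a Teichmüller `ω` mod `3`, any `ℚ₃`-valued `ψ` with `ψ² = 1` and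
  `ψ(ℓ) = (d/ℓ)` at the primes `ℓ ≡ 1 (mod 3)`, `ℓ ∤ 3N`, and `h2` (`a₂ = 0` if good at `2`):
  Kriz–Li's `hss` at `p = 3`.

References: [SilvermanATAEC1994] IV.9.4 (Tate's algorithm), Table 4.1; [SilvermanAEC2009] VII.1
Rem. 1.1; [KrizLi2019] Thm. 1.20 (pp. 7–8), §10.1; `X12/CubicModelKodaira.lean` (b2b-bsdres x1b).
-/

set_option linter.dupNamespace false
set_option autoImplicit false

noncomputable section

open scoped Classical
open NumberField IsDedekindDomain IsDedekindDomain.HeightOneSpectrum Field WeierstrassCurve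
open Literature.NumberTheory.EllipticCurves Literature.NumberTheory.EllipticCurves.KrizLi2019
  Rat.HeightOneSpectrum Literature.NumberTheory.DiophantineGeometry

namespace Summit.BirchSwinnertonDyer.BirchSwinnertonDyer.Theorems.PrintCFram

/-! ## §1 Tate: `y² = x³ + k` is bad at `ℓ ≥ 5` when `ℓ ∣ k`, `ℓ⁶ ∤ k` -/

/-- **A curve `W ≅ y² = x³ + k` (`k ∈ ℤ`) is BAD at every prime `ℓ ≥ 5` with `ℓ ∣ k`, `ℓ⁶ ∤ k`.**
Write `k = ℓˢ·m`, `ℓ ∤ m`, `1 ≤ s ≤ 5`; the model `y² = x³ + k` (`= C • W`) has `ord_v k = s` at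
the place `v` over `ℓ`, so Tate's algorithm (tree engine `X12.kodairaSymbolAt_of_cubic_model`,
*ATAEC* IV.9.4) gives Kodaira type `II, IV, I₀*, IV*, II*` at `v` — not `I₀`, i.e. not good
reduction (`TateAlgorithm.isGood_kodairaSymbolAt_iff_holds`).
[cite: SilvermanATAEC1994, IV.9.4 Steps 1–10 and Table 4.1] [cite: SilvermanAEC2009, VII.1 Remark 1.1] -/
theorem not_hasGoodReductionAtPrime_of_dvd_mordell (W : WeierstrassCurve ℚ) [W.IsElliptic]
    {k : ℤ} (hW : ∃ C : VariableChange ℚ, C • W = mordellCurve (k : ℚ))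
    (ℓ : ℕ) [hℓ : Fact ℓ.Prime] (hℓ5 : 5 ≤ ℓ) (hℓk : (ℓ : ℤ) ∣ k) (hℓ6 : ¬ (ℓ : ℤ) ^ 6 ∣ k) :
    ¬ W.HasGoodReductionAtPrime ℓ := by
  have hk0 : k ≠ 0 := by rintro rfl; exact hℓ6 (dvd_zero _)
  -- `k = ℓ^s · m`, `ℓ ∤ m`, `1 ≤ s ≤ 5`
  set s : ℕ := padicValInt ℓ k with hs
  have hs1 : 1 ≤ s := by
    rcases (padicValInt_dvd_iff (p := ℓ) 1 k).mp (by simpa using hℓk) with h | h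
    · exact absurd h hk0
    · exact h
  have hs5 : s ≤ 5 := by
    by_contra h6
    have h6' : 6 ≤ s := by omega
    exact hℓ6 (dvd_trans (pow_dvd_pow (ℓ : ℤ) h6') (hs ▸ padicValInt_dvd k))
  obtain ⟨m, hkm⟩ : ∃ m : ℤ, k = (ℓ : ℤ) ^ s * m := hs ▸ padicValInt_dvd k
  have hℓm : ¬ (ℓ : ℤ) ∣ m := by
    rintro ⟨m', rfl⟩
    have hdvd : (ℓ : ℤ) ^ (s + 1) ∣ k := ⟨m', by rw [hkm]; ring⟩
    rcases (padicValInt_dvd_iff (p := ℓ) (s + 1) k).mp hdvd with h | h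
    · exact hk0 h
    · omega
  -- the place `v` over `ℓ`
  set v : HeightOneSpectrum (𝓞 ℚ) := (primesEquiv (R := 𝓞 ℚ)).symm ⟨ℓ, hℓ.out⟩ with hvdef
  have hv : (primesEquiv v : ℕ) = ℓ := by rw [hvdef, Equiv.apply_symm_apply]
  have hng : natGenerator v = ℓ := hv
  have hv2 : natGenerator v ≠ 2 := by rw [hng]; omega
  have hv3 : natGenerator v ≠ 3 := by rw [hng]; omega
  -- `ord_v k = s`
  have hb : v.valuation ℚ ((k : ℤ) : ℚ) = WithZero.exp (-(s : ℤ)) := by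
    have h := WeierstrassCurve.Rat.valuation_pow_mul_intCast v (m := m) (by rw [hng]; exact hℓm) s
    rw [hng] at h
    rw [hkm]; push_cast
    exact h
  -- Tate's algorithm on `C • W = y² = x³ + k`
  obtain ⟨C, hC⟩ := hW
  haveI := perfectField_residueField_adicCompletionIntegers (K := ℚ) v
  have hT := Rank1Residual.X12.kodairaSymbolAt_of_cubic_model W v hv2 hv3 (mordellCurve (k : ℚ)) C hC.symm
    (b := ((k : ℤ) : ℚ)) rfl hs1 hs5 hb
  have hnot : ¬ (W.kodairaSymbolAt v).IsGood := by
    rw [hT]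
    unfold KodairaSymbol.IsGood
    split_ifs <;> simp
  intro hgood
  have hgood' : W.HasGoodReductionAt v := (hasGoodReductionAtPrime_primesEquiv_iff_holds W v ℓ hv).mp hgood
  exact hnot ((WeierstrassCurve.isGood_kodairaSymbolAt_iff_holds v W).mpr hgood')

/-- **`3` is bad for every model of `y² = x³ + k`** (`j = 0`: `c₄(y² = x³ + k) = 0`, `j` is an
isomorphism invariant; tree `JZeroThree.not_good_three_of_j_eq_zero`).
[cite: SilvermanATAEC1994, App. A §3 (CM curves are bad at the ramified primes)] -/
theorem not_hasGoodReductionAtPrime_three_mordell (W : WeierstrassCurve ℚ) [W.IsElliptic]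
    {k : ℚ} (hW : ∃ C : VariableChange ℚ, C • W = mordellCurve k) :
    ¬ (haveI : Fact (Nat.Prime 3) := ⟨Nat.prime_three⟩; W.HasGoodReductionAtPrime 3) := by
  haveI : Fact (Nat.Prime 3) := ⟨Nat.prime_three⟩
  obtain ⟨C, hC⟩ := hW
  have hj : W.j = 0 := by
    have h1 : (C • W).j = W.j := variableChange_j W C
    have hc4 : (C • W).c₄ = 0 := by rw [hC, mordellCurve_c₄]
    have h2 : (C • W).j = 0 := by
      rw [WeierstrassCurve.j, hc4]
      simp
    rw [← h1, h2]
  exact Rank1Residual.X12.JZeroThree.not_good_three_of_j_eq_zero W hj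

/-! ## §2 The `hbad` binder for `k = d·m²` sixth-power-free -/

/-- **`hbad` DISCHARGED for the sixth-power-free normal form.** If `C • W = y² = x³ + d·m²` with
`d, m ∈ ℤ`, `d` squarefree and `k = d·m²` sixth-power-free (`ℓ⁶ ∤ k` for every prime `ℓ`), then
`W` is bad at every ODD prime `ℓ ∣ d`: at `ℓ = 3` because `j = 0`, at `ℓ ≥ 5` by Tate
(`not_hasGoodReductionAtPrime_of_dvd_mordell`, `ℓ ∣ d ∣ k`). This is exactly the binder `hbad` of
`PrintCFram.hss_three_of_sq_twist`. [cite: SilvermanATAEC1994, IV.9.4 and Table 4.1] -/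
theorem hbad_of_sixthPowerFree (W : WeierstrassCurve ℚ) [W.IsElliptic] {d m : ℤ}
    (hW : ∃ C : VariableChange ℚ, C • W = mordellCurve ((d : ℚ) * (m : ℚ) ^ 2))
    (h6 : ∀ ℓ : ℕ, ℓ.Prime → ¬ ((ℓ : ℤ) ^ 6 ∣ d * m ^ 2)) :
    ∀ ℓ : ℕ, (hℓ : ℓ.Prime) → (ℓ : ℤ) ∣ d → ℓ ≠ 2 →
      ¬ (haveI := Fact.mk hℓ; W.HasGoodReductionAtPrime ℓ) := by
  intro ℓ hℓ hℓd hℓ2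
  haveI := Fact.mk hℓ
  have hW' : ∃ C : VariableChange ℚ, C • W = mordellCurve (((d * m ^ 2 : ℤ)) : ℚ) := by
    obtain ⟨C, hC⟩ := hW; exact ⟨C, by rw [hC]; push_cast; rfl⟩
  by_cases hℓ3 : ℓ = 3
  · subst hℓ3
    exact not_hasGoodReductionAtPrime_three_mordell W hW'
  · have hℓ5 : 5 ≤ ℓ := by
      by_contra h
      have h2 := hℓ.two_le
      interval_cases ℓ
      · exact hℓ2 rfl
      · exact hℓ3 rfl
      · exact absurd hℓ (by decide)
    exact not_hasGoodReductionAtPrime_of_dvd_mordell W hW' ℓ hℓ5 (dvd_mul_of_dvd_left hℓd _) (h6 ℓ hℓ)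

/-! ## §3 `hss` for the integral sixth-power-free normal form, `hbad` discharged -/

/-- **The `hss` binder of Kriz–Li Thm. 1.20 / ROUTE U at `p = 3` for `W ≅ y² = x³ + d·m²` with
`d·m²` a SIXTH-POWER-FREE INTEGER** (`d` squarefree, `m ≠ 0`): `PrintCFram.hss_three_of_sq_twist`
with its `hbad` binder discharged by §2. Remaining per-curve input: `h2` (`a₂(W) = 0` if `W` is
good at `2`; vacuous when `2 ∣ N`). `ψ`: any `ℚ₃`-valued Dirichlet character with `ψ² = 1` and
`ψ(ℓ) = (d/ℓ)` at the primes `ℓ ≡ 1 (mod 3)`, `ℓ ∤ 3N`. [cite: KrizLi2019, Thm. 1.20 (pp. 7–8), §7.1 (p. 42), §10.1]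
[cite: SilvermanATAEC1994, IV.9.4 and Table 4.1] -/
theorem hss_three_of_mordell_int (W : WeierstrassCurve ℚ) [W.IsElliptic] [W.IsGloballyMinimal]
    {d m : ℤ} (hd : Squarefree d) (hm : m ≠ 0)
    (hW : ∃ C : VariableChange ℚ, C • W = mordellCurve ((d : ℚ) * (m : ℚ) ^ 2))
    (h6 : ∀ ℓ : ℕ, ℓ.Prime → ¬ ((ℓ : ℤ) ^ 6 ∣ d * m ^ 2))
    (h2 : (haveI : Fact (Nat.Prime 2) := ⟨Nat.prime_two⟩; W.HasGoodReductionAtPrime 2) →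
      W.LFunction 2 = 0)
    {f : ℕ} (ψ : DirichletCharacter ℚ_[3] f) (ω : DirichletCharacter ℚ_[3] 3)
    (hω : IsTeichmullerCharacter ω) (hψ2 : ψ * ψ = 1)
    (hψ : ∀ ℓ : ℕ, ℓ.Prime → ¬ (ℓ ∣ 3 * W.conductorNorm ℤ) → ℓ % 3 = 1 →
      ψ (ℓ : ZMod f) = ((jacobiSym d ℓ : ℤ) : ℚ_[3])) :
    ∀ ℓ : ℕ, ℓ.Prime → ¬ (ℓ ∣ 3 * W.conductorNorm ℤ) →
      ‖((W.LFunction ℓ : ℤ) : ℚ_[3]) -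
        (ψ (ℓ : ZMod f) + ψ⁻¹ (ℓ : ZMod f) * ω (ℓ : ZMod 3))‖ < 1 :=
  hss_three_of_sq_twist W hd (m := (m : ℚ)) (by exact_mod_cast hm) hW h2
    (hbad_of_sixthPowerFree W hW h6) ψ ω hω hψ2 hψ

end Summit.BirchSwinnertonDyer.BirchSwinnertonDyer.Theorems.PrintCFram

end
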